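import Summits.Ventures.Crystal3D.Theorems.StickyWulffConstantTextureBuildExposedContainer
import Summits.Ventures.Crystal3D.Theorems.StickyWulffConstantTextureBuildTentZoneCells
import Summits.Ventures.Crystal3D.Theorems.StickyWulffConstantTextureBuildCoplanarFacets
import Summits.Ventures.Crystal3D.Theorems.StickyWulffConstantPolycrystalWulffBoundFacetAreaSymm
import Summits.Ventures.Crystal3D.Theorems.StickyWulffConstantTextureBuildCoveringKit
import HarnessLib

/-!
# TB-energy blueprint, stub_LP1 ROW (T): TENT cells expose only their free surface (in the tent zone) — incl. T2, the layer-plane facets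
# (lane T, crux `TextureLiminfV5`, stmt-Ventures-23912; TB-D-3-g20 §LP1 row (T); engine …ExposedFar/…ExposedContainer; T0's `LayerPlaneCover`)

HONEST FRAMING. Venture `Summits/Ventures/Crystal3D` (cell `crystal3d-full`), route `route-Ventures-StickyWulffConstant`, helper `--supports` the
law-v5 crux `TextureLiminfV5` (stmt-Ventures-23912).  Bookkeeping over the labelled cells of a texture input (standard axioms; no mesh constructed; F-C1 not moved).

WHAT.  `exposed_tent_eq_zero`: for a piece that is a TENT cell (inside a certificate piece `H_f jc`, a territory polytope `HD f jd`, its own slab `s`, and no core)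
the exposed part of each facet outside `zone (cls i) = U_f ∩ laySlab_f s` and the designated regions (either orientation) is null.  Generic exposed point `y`:
inside `D_f` near the core ⇒ `hcollar₃` makes the far side solid; in `U_f ∩ laySlab s` ⇒ in the zone; in `U_f` on a layer plane (then the facet datum IS the
layer datum) ⇒ off T0's `LayerPlaneCover` null set `y` lies in the closure of ANOTHER certificate piece, which (off the same-side null set, by genericity and
disjointness) carries the antipodal datum, so the far half-ball lies in it — material; on the frontier of `D_f` ⇒ `hbdry`.  Engine variant with an extra null set:
`facetArea_exposed_diff_eq_zero_null`.
-/

noncomputable section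

open scoped BigOperators InnerProductSpace ENNReal
open MeasureTheory Set

namespace Summit.Ventures.Crystal3D.Cruxes.TextureLiminf.TexShadow

open Summit.Ventures.Crystal3D Summit.Ventures.Crystal3D.Theorems
open Summit.Ventures.Crystal3D.TentCertificate (mem_laySlab_iff height_move move_symm isOpen_laySlab)

/-! ### Small geometry -/

/-- Near a point strictly inside all constraints of `H` other than the antipode of `q`, the far half-ball of `q` lies in `polytope H`. -/
theorem exists_ball_far_subset_polytope {H : Finset (E3 × ℝ)} {q : E3 × ℝ} {y : E3}
    (hy : ∀ p ∈ H, p ≠ antip q → ⟪p.1, y⟫_ℝ < p.2) :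
    ∃ ε : ℝ, 0 < ε ∧ Metric.ball y ε ∩ {z : E3 | q.2 < ⟪q.1, z⟫_ℝ} ⊆ polytope H := by
  classical
  have hyO : y ∈ polytope (H.erase (antip q)) := by
    simp only [polytope, mem_iInter, mem_setOf_eq]
    exact fun p hp => hy p (Finset.mem_of_mem_erase hp) (Finset.ne_of_mem_erase hp)
  obtain ⟨ε, hε, hball⟩ := Metric.isOpen_iff.1 (isOpen_polytopeH (H.erase (antip q))) y hyO
  refine ⟨ε, hε, fun z hz => ?_⟩
  have hz1 := hball hz.1
  simp only [polytope, mem_iInter, mem_setOf_eq] at hz1 ⊢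
  intro p hp
  by_cases hpq : p = antip q
  · subst hpq
    simp only [antip, inner_neg_left, neg_lt_neg_iff]
    exact hz.2
  · exact hz1 p (Finset.mem_erase.2 ⟨hpq, hp⟩)

/-- The closure of a slab minus the slab lies on its two layer planes (as height equations). -/
theorem height_eq_of_mem_closure_laySlab_diff (L : E3 ≃ₗᵢ[ℝ] E3) (s : E3) (i : ℤ) {y : E3} (hyc : y ∈ closure (laySlab L s i))
    (hy : y ∉ laySlab L s i) : TentCertificate.height L s y = (i : ℝ) * TentCertificate.hB ∨ TentCertificate.height L s y = ((i : ℝ) + 1) * TentCertificate.hB := by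
  have hcont : Continuous fun y : E3 => TentCertificate.height L s y := by
    have : (fun y : E3 => TentCertificate.height L s y) = fun y => ⟪L e₃, y⟫_ℝ - ⟪L e₃, s⟫_ℝ := funext fun y => height_eq_inner L s y
    rw [this]; fun_prop
  have hsub : laySlab L s i ⊆ {y : E3 | (i : ℝ) * TentCertificate.hB ≤ TentCertificate.height L s y ∧ TentCertificate.height L s y ≤ ((i : ℝ) + 1) * TentCertificate.hB} :=
    fun y hy => by rw [mem_laySlab_iff] at hy; exact ⟨hy.1.le, hy.2.le⟩
  have hcl : IsClosed {y : E3 | (i : ℝ) * TentCertificate.hB ≤ TentCertificate.height L s y ∧ TentCertificate.height L s y ≤ ((i : ℝ) + 1) * TentCertificate.hB} :=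
    (isClosed_le continuous_const hcont).inter (isClosed_le hcont continuous_const)
  have hy' := (closure_minimal hsub hcl) hyc
  rw [mem_laySlab_iff] at hy
  simp only [mem_setOf_eq] at hy'
  by_contra h
  rw [not_or] at h
  exact hy ⟨lt_of_le_of_ne hy'.1 (Ne.symm h.1), lt_of_le_of_ne hy'.2 h.2⟩

/-- Layer planes as height level sets. -/
theorem mem_layerPlane_iff_height (L : E3 ≃ₗᵢ[ℝ] E3) (s : E3) (i : ℤ) (y : E3) :
    y ∈ layerPlane L s i ↔ TentCertificate.height L s y = (i : ℝ) * TentCertificate.hB := by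
  constructor
  · rintro ⟨r, hr, rfl⟩
    rw [height_move]; exact hr
  · intro h
    exact ⟨L.symm (y - s), h, move_symm L s y⟩

namespace TexInput

variable {C R₀ : ℝ} {N : ℕ} {x : Fin N → E3} {rc : RiseredCover C R₀ N x} {δ : ℝ} {μ : Mesh₅ rc δ} (I : TexInput rc μ)

/-! ### Engine variant with an extra null set -/

/-- **Exposed-classification scheme with a null exceptional set**: as `facetArea_exposed_diff_eq_zero`, but generic points of a facet-null set `Nset` need
no ball. -/
theorem facetArea_exposed_diff_eq_zero_null (i : Fin I.cells.M) {q : E3 × ℝ} (hq : q ∈ I.cells.Hp i) (A Nset : Set E3)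
    (hNsub : Nset ⊆ closure (polytope (I.cells.Hp i))) (hN : facetArea Nset q.1 = 0)
    (h : ∀ y ∈ I.exposed i q, y ∉ A → y ∉ Nset → I.Generic q y →
      ∃ ρ : ℝ, 0 < ρ ∧ ∀ z ∈ Metric.ball y ρ, q.2 < ⟪q.1, z⟫_ℝ → z ∉ I.massNull → z ∈ I.pieceSet) :
    facetArea (I.exposed i q \ A) q.1 = 0 := by
  refine le_antisymm ?_ (facetArea_nonneg _ _)
  by_cases hex : ∃ y ∈ I.exposed i q, y ∉ A ∧ y ∉ Nset ∧ I.Generic q y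
  · obtain ⟨y, hyE, hyA, hyN, hgen⟩ := hex
    obtain ⟨ρ, hρ, hfar⟩ := h y hyE hyA hyN hgen
    have h0 := I.facetArea_exposed_eq_zero_of_far i hq hyE.1.2 hyE.1.1 hgen hρ hfar
    rw [← h0]
    exact facetArea_mono_of_subset (I.cells.hbd_Hp i) (fun z hz => hz.1.1) sdiff_subset q.1
  · simp only [not_exists, not_and] at hex
    have hle := facetArea_le_add (I.cells.hbd_Hp i) (A := {y : E3 | y ∈ closure (polytope (I.cells.Hp i)) ∧ ⟪q.1, y⟫_ℝ = q.2 ∧ ¬ I.Generic q y})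
      (B := Nset) (F := I.exposed i q \ A) (fun z hz => hz.1) hNsub (fun z hz => ?_) q.1
    · rw [I.facetArea_nonGeneric_eq_zero' i hq, hN, add_zero] at hle
      exact hle
    · by_cases hzN : z ∈ Nset
      · exact Or.inr hzN
      · left
        simp only [mem_setOf_eq]
        exact ⟨hz.1.1.1, hz.1.1.2, hex z hz.1 hz.2 hzN⟩

/-! ### Tent data of a piece -/

/-- Certificate pieces inside the territory are covered: a point of `polytope (H_f j′) ∩ polytope (HD f jd)` off the null set lies in the pieces. -/
theorem mem_pieceSet_of_certH_of_HD (f : Fin rc.ng) (j' : Fin (I.ct f).J) (jd : Fin (μ.nD f)) {z : E3} (hzH : z ∈ polytope ((I.ct f).H j'))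
    (hzD : z ∈ polytope (μ.HD f jd)) (hzN : z ∉ I.massNull) : z ∈ I.pieceSet := by
  have hG : (I.ct f).H j' ∈ I.𝒢 := by
    simp only [𝒢, Finset.mem_union, Finset.mem_biUnion, Finset.mem_univ, true_and, Finset.mem_image]
    exact Or.inr ⟨f, j', rfl⟩
  obtain ⟨j, hzj⟩ := I.exists_cell_of_mem hG hzH hzN
  have hne : (polytope (signedH I.𝓗 (I.cells.T j))).Nonempty := ⟨z, hzj⟩
  have hH : (I.ct f).H j' ⊆ I.cells.T j :=
    subset_T_of_cell_subset (I.certH_subset_𝓗 f j') hne (refineCells_subset_of_mem _ _ _ _ _ _ _ j (I.certH_subset_𝓗 f j') hzj hzH)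
  have hHD : μ.HD f jd ⊆ I.cells.T j := subset_T_of_cell_subset (I.HD_subset_𝓗 f jd) hne (I.cell_subset_HD_of_mem hzj hzD)
  have hgr : (I.grainOf (I.cells.T j)).isSome = true := by
    by_cases hc : ∃ f' : Fin rc.ng, ∃ jj, μ.HC f' jj ⊆ I.cells.T j
    · exact I.isSome_grainOf (Or.inl hc)
    · exact I.isSome_grainOf (Or.inr (Or.inl ⟨f, ⟨j', hH⟩, ⟨jd, hHD⟩⟩))
  obtain ⟨g, hg⟩ := Option.isSome_iff_exists.1 hgr
  exact I.mem_pieceSet_of_isSome (I.isSome_lab_of_grainOf j hg) hzj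

/-- **Tent data of a piece that is not a core / prism / gap / box cell**: its grain `f`, a certificate piece and a territory polytope containing it, its own
slab `s`, and its class `enc (f, s)`. -/
theorem tent_data (i : Fin I.cells.M) (hcore : ¬ ∃ (f : Fin rc.ng) (jc : Fin (μ.nC f)), polytope (I.cells.Hp i) ⊆ polytope (μ.HC f jc))
    (hprism : ¬ ∃ k, polytope (I.cells.Hp i) ⊆ polytope (μ.HP k)) (hgap : ¬ ∃ l, polytope (I.cells.Hp i) ⊆ polytope (μ.HQ l))
    (hbox : ¬ ∃ r, polytope (I.cells.Hp i) ⊆ polytope (μ.HB r)) :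
    ∃ (f : Fin rc.ng) (jc : Fin (I.ct f).J) (jd : Fin (μ.nD f)) (s : {s : ℤ // s ∈ I.slabWindow f}),
      polytope (I.cells.Hp i) ⊆ polytope ((I.ct f).H jc) ∧ polytope (I.cells.Hp i) ⊆ polytope (μ.HD f jd) ∧
      polytope (I.cells.Hp i) ⊆ laySlab (rc.tent f).L (rc.tent f).s s.1 ∧ I.cells.cls i = I.enc ⟨f, s⟩ := by
  classical
  set T := I.cells.T (I.cells.idx i) with hT
  have hcell : polytope (I.cells.Hp i) = polytope (signedH I.𝓗 T) := rfl
  have hlab : I.lab₀ T = some (I.cells.cls i) := I.cells.lab_idx i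
  -- the four non-tent branches are off
  have hc' : ¬ ∃ f : Fin rc.ng, ∃ j, μ.HC f j ⊆ T := by
    rintro ⟨f, j, h⟩; exact hcore ⟨f, j, by rw [hcell]; exact cell_subset_of_subset_T (I.HC_subset_𝓗 f j) h⟩
  have hp' : ¬ ∃ k : Fin rc.nk, μ.HP k ⊆ T := by
    rintro ⟨k, h⟩; exact hprism ⟨k, by rw [hcell]; exact cell_subset_of_subset_T (I.HP_subset_𝓗 k) h⟩
  have hq' : ¬ ∃ l : Fin μ.nQ, μ.HQ l ⊆ T := by
    rintro ⟨l, h⟩; exact hgap ⟨l, by rw [hcell]; exact cell_subset_of_subset_T (I.HQ_subset_𝓗 l) h⟩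
  have hb' : ¬ ∃ r : Fin rc.nr, μ.HB r ⊆ T := by
    rintro ⟨r, h⟩; exact hbox ⟨r, by rw [hcell]; exact cell_subset_of_subset_T (I.HB_subset_𝓗 r) h⟩
  -- so the grain comes from the tent branch
  have hgr : ∃ f, I.grainOf T = some f ∧ (∃ j, (I.ct f).H j ⊆ T) ∧ ∃ j', μ.HD f j' ⊆ T := by
    by_cases ht : ∃ f : Fin rc.ng, (∃ j, (I.ct f).H j ⊆ T) ∧ ∃ j', μ.HD f j' ⊆ T
    · refine ⟨Classical.choose ht, ?_, (Classical.choose_spec ht).1, (Classical.choose_spec ht).2⟩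
      unfold grainOf; rw [dif_neg hc', dif_pos ht]
    · exfalso
      have hnone : I.grainOf T = none := by unfold grainOf; rw [dif_neg hc', dif_neg ht, dif_neg hp', dif_neg hq', dif_neg hb']
      have : I.lab₀ T = none := by unfold lab₀; rw [hnone]; rfl
      rw [this] at hlab; cases hlab
  obtain ⟨f, hgf, ⟨jc, hjc⟩, ⟨jd, hjd⟩⟩ := hgr
  -- and the slab from the slab branch
  have hsl : ∃ s : {s : ℤ // s ∈ I.slabWindow f}, I.slabOf f T = some s ∧ laySlabH (rc.tent f).L (rc.tent f).s s.1 ⊆ T := by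
    by_cases hs : ∃ s : {s : ℤ // s ∈ I.slabWindow f}, laySlabH (rc.tent f).L (rc.tent f).s s.1 ⊆ T
    · refine ⟨Classical.choose hs, ?_, Classical.choose_spec hs⟩
      unfold slabOf; rw [dif_pos hs]
    · exfalso
      have hnone : I.slabOf f T = none := by unfold slabOf; rw [dif_neg hs]
      have : I.lab₀ T = none := by unfold lab₀; rw [hgf, Option.bind_some, hnone]; rfl
      rw [this] at hlab; cases hlab
  obtain ⟨s, hsf, hsT⟩ := hsl
  refine ⟨f, jc, jd, s, ?_, ?_, ?_, ?_⟩
  · rw [hcell]; exact cell_subset_of_subset_T (I.certH_subset_𝓗 f jc) hjc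
  · rw [hcell]; exact cell_subset_of_subset_T (I.HD_subset_𝓗 f jd) hjd
  · rw [hcell, laySlab_eq_polytope]; exact cell_subset_of_subset_T (I.laySlabH_subset_𝓗 f s.2) hsT
  · have : I.lab₀ T = some (I.enc ⟨f, s⟩) := by unfold lab₀; rw [hgf, Option.bind_some, hsf, Option.map_some]
    rw [this] at hlab
    exact (Option.some_injective _ hlab).symm

/-- The zone of the class `enc (f, s)` is `U_f ∩ laySlab_f s`. -/
theorem zone_enc (f : Fin rc.ng) (s : {s : ℤ // s ∈ I.slabWindow f}) :
    I.zone (I.enc ⟨f, s⟩) = (rc.tent f).U ∩ laySlab (rc.tent f).L (rc.tent f).s s.1 := by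
  have hc : I.enc.symm (I.enc ⟨f, s⟩) = ⟨f, s⟩ := Equiv.symm_apply_apply _ _
  unfold zone
  rw [hc]

/-! ### ROW (T) -/

/-- **ROW (T) of stub_LP1 — TENT cells expose only free surface inside their tent zone, or designated regions.** -/
theorem exposed_tent_eq_zero (i : Fin I.cells.M) (hcore : ¬ ∃ (f : Fin rc.ng) (jc : Fin (μ.nC f)), polytope (I.cells.Hp i) ⊆ polytope (μ.HC f jc))
    (hprism : ¬ ∃ k, polytope (I.cells.Hp i) ⊆ polytope (μ.HP k)) (hgap : ¬ ∃ l, polytope (I.cells.Hp i) ⊆ polytope (μ.HQ l))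
    (hbox : ¬ ∃ r, polytope (I.cells.Hp i) ⊆ polytope (μ.HB r)) {q : E3 × ℝ} (hq : q ∈ I.cells.Hp i) :
    facetArea (I.exposed i q \ (I.zone (I.cells.cls i) ∪ μ.desOf q)) q.1 = 0 := by
  classical
  obtain ⟨f, jc, jd, s, hH, hD, hS, hcls⟩ := I.tent_data i hcore hprism hgap hbox
  set L := (rc.tent f).L with hL
  set sf := (rc.tent f).s with hsf
  have hne : (polytope (I.cells.Hp i)).Nonempty := I.cells.hne _
  have hq1 : ‖q.1‖ = 1 := I.cells.hunit_Hp i q hq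
  -- the certificate piece `jc` lies in slab `s`
  have hslab_jc : (I.ct f).slabOf jc = s.1 := by
    by_contra hne'
    obtain ⟨z, hz⟩ := hne
    exact Set.disjoint_left.1 (TentCertificate.disjoint_laySlab L sf hne') ((I.ct f).hslab jc (hH hz)) (hS hz)
  -- the cell lies on the `q`-side
  have hside : polytope (I.cells.Hp i) ⊆ {z : E3 | ⟪q.1, z⟫_ℝ < q.2} := fun z hz => by
    simp only [polytope, mem_iInter, mem_setOf_eq] at hz; exact hz q hq
  -- THE NULL SET: (LP) uncovered layer-plane points of piece `jc` (only when `q.1 = ± L e₃`), (SS) same-side traces of other pieces carrying `q`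
  set NLP : Set E3 := if q.1 = L e₃ ∨ q.1 = -(L e₃) then
      ((closure (polytope ((I.ct f).H jc)) ∩ (layerPlane L sf ((I.ct f).slabOf jc) ∪ layerPlane L sf ((I.ct f).slabOf jc + 1))) \
        ⋃ j' : {j' : Fin (I.ct f).J // j' ≠ jc}, closure (polytope ((I.ct f).H j'))) ∩ closure (polytope (I.cells.Hp i))
    else ∅ with hNLP
  set NSS : Set E3 := ⋃ j' ∈ (Finset.univ.filter fun j' : Fin (I.ct f).J => j' ≠ jc ∧ q ∈ (I.ct f).H j' ∧ polytope ((I.ct f).H jc) ⊆ {z : E3 | ⟪q.1, z⟫_ℝ < q.2}),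
      (closure (polytope ((I.ct f).H jc)) ∩ closure (polytope ((I.ct f).H j')) ∩ {z : E3 | ⟪q.1, z⟫_ℝ = q.2} ∩ closure (polytope (I.cells.Hp i))) with hNSS
  have hNLP0 : facetArea NLP q.1 = 0 := by
    by_cases hqL : q.1 = L e₃ ∨ q.1 = -(L e₃)
    · simp only [hNLP, if_pos hqL]
      have hcov := (I.ct f).hcover jc
      have hq1' : facetArea (((closure (polytope ((I.ct f).H jc)) ∩ (layerPlane L sf ((I.ct f).slabOf jc) ∪ layerPlane L sf ((I.ct f).slabOf jc + 1))) \
          ⋃ j' : {j' : Fin (I.ct f).J // j' ≠ jc}, closure (polytope ((I.ct f).H j')))) q.1 = 0 := by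
        rcases hqL with h | h
        · rw [h]; exact hcov
        · rw [h, Theorems.facetArea_neg]; exact hcov
      refine le_antisymm ?_ (facetArea_nonneg _ _)
      rw [← hq1']
      exact facetArea_mono_of_subset ((I.ct f).hbd jc) (fun z hz => hz.1.1) inter_subset_left q.1
    · simp only [hNLP, if_neg hqL]
      unfold facetArea; simp
  have hNSS0 : facetArea NSS q.1 = 0 := by
    refine le_antisymm ?_ (facetArea_nonneg _ _)
    have h := facetArea_le_sum_of_subset_iUnion
      (Finset.univ.filter fun j' : Fin (I.ct f).J => j' ≠ jc ∧ q ∈ (I.ct f).H j' ∧ polytope ((I.ct f).H jc) ⊆ {z : E3 | ⟪q.1, z⟫_ℝ < q.2}) NSS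
      (fun j' => closure (polytope ((I.ct f).H jc)) ∩ closure (polytope ((I.ct f).H j')) ∩ {z : E3 | ⟪q.1, z⟫_ℝ = q.2}) q.1
      (fun z hz => by
        obtain ⟨j', hj', hz'⟩ := mem_iUnion₂.1 hz
        exact mem_iUnion₂.2 ⟨j', hj', hz'.1⟩)
      (fun j' _ => volume_prism_ne_top_of_isBounded ((I.ct f).hbd jc) _ (fun z hz => hz.1.1) q.1)
    refine h.trans (le_of_eq (Finset.sum_eq_zero fun j' hj' => ?_))
    obtain ⟨hne', hqj', hsidejc⟩ := (Finset.mem_filter.1 hj').2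
    have hsidej' : polytope ((I.ct f).H j') ⊆ {z : E3 | ⟪q.1, z⟫_ℝ < q.2} := fun z hz => by
      simp only [polytope, mem_iInter, mem_setOf_eq] at hz; exact hz q hqj'
    exact facetArea_inter_eq_zero_of_sameSide hq1 hsidejc hsidej' ((I.ct f).hdisj jc j' (Ne.symm hne'))
  refine I.facetArea_exposed_diff_eq_zero_null i hq _ (NLP ∪ NSS)
    (fun z hz => by
      rcases hz with hz | hz
      · by_cases hqL : q.1 = L e₃ ∨ q.1 = -(L e₃)
        · simp only [hNLP, if_pos hqL] at hz; exact hz.2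
        · simp only [hNLP, if_neg hqL] at hz; exact hz.elim
      · obtain ⟨j', -, hz'⟩ := mem_iUnion₂.1 hz
        exact hz'.2)
    (by
      refine le_antisymm ?_ (facetArea_nonneg _ _)
      have := facetArea_le_add (I.cells.hbd_Hp i) (A := NLP) (B := NSS) (F := NLP ∪ NSS) ?_
        (fun z hz => by obtain ⟨j', -, hz'⟩ := mem_iUnion₂.1 hz; exact hz'.2) subset_rfl q.1
      · rw [hNLP0, hNSS0, add_zero] at this; exact this
      · intro z hz
        by_cases hqL : q.1 = L e₃ ∨ q.1 = -(L e₃)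
        · simp only [hNLP, if_pos hqL] at hz; exact hz.2
        · simp only [hNLP, if_neg hqL] at hz; exact hz.elim)
    fun y hyE hyA hyN hgen => ?_
  have hycl : y ∈ closure (polytope (I.cells.Hp i)) := hyE.1.1
  have hyq : ⟪q.1, y⟫_ℝ = q.2 := hyE.1.2
  have hyH : y ∈ closure (polytope ((I.ct f).H jc)) := closure_mono hH hycl
  have hyDcl : y ∈ closure (⋃ j, polytope (μ.HD f j)) := closure_mono (hD.trans (subset_iUnion (fun j => polytope (μ.HD f j)) jd)) hycl
  have hzone : I.zone (I.cells.cls i) = (rc.tent f).U ∩ laySlab L sf s.1 := by rw [hcls, I.zone_enc]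
  by_cases hyin : y ∈ ⋃ j, polytope (μ.HD f j)
  · obtain ⟨jd', hjd'⟩ := mem_iUnion.1 hyin
    obtain ⟨ε₁, hε₁, hball₁⟩ := Metric.isOpen_iff.1 (isOpen_polytopeH (μ.HD f jd')) y hjd'
    by_cases hyCore : y ∈ closure (⋃ j, polytope (μ.HC f j))
    · -- near the core: the collar is solid
      refine ⟨min ε₁ 1, lt_min hε₁ one_pos, fun z hz _ hzN => ?_⟩
      have hzD : z ∈ polytope (μ.HD f jd') := hball₁ (Metric.ball_subset_ball (min_le_left _ _) hz)
      refine I.mem_pieceSet_of_territory f (subset_closure (mem_iUnion.2 ⟨jd', hzD⟩)) (fun hzU => ?_) hzN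
      refine μ.hcollar₃ f z hzU (lt_of_le_of_lt ?_ (show dist z y < 1 from lt_of_lt_of_le (Metric.mem_ball.1 hz) (min_le_right _ _)))
      have := Metric.infDist_le_infDist_add_dist (x := z) (y := y) (s := ⋃ j, polytope (μ.HC f j))
      rw [Metric.infDist_zero_of_mem_closure hyCore, zero_add] at this
      exact this
    · -- in the free zone
      have hyU : y ∈ (rc.tent f).U := by rw [μ.hU f]; exact ⟨hyin, hyCore⟩
      by_cases hysl : y ∈ laySlab L sf s.1
      · exact absurd (Or.inl (by rw [hzone]; exact ⟨hyU, hysl⟩)) hyA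
      · -- on a layer plane of slab `s`: ROW T2
        have hyslc : y ∈ closure (laySlab L sf s.1) := closure_mono hS hycl
        have hh := height_eq_of_mem_closure_laySlab_diff L sf s.1 hyslc hysl
        -- the layer datum through `y` is `q`
        have hdat : ∃ p₀ ∈ laySlabH L sf s.1, ⟪p₀.1, y⟫_ℝ = p₀.2 := by
          rcases hh with h | h
          · refine ⟨(-(L e₃), -((s.1 : ℝ) * TentCertificate.hB + ⟪L e₃, sf⟫_ℝ)), by simp [laySlabH], ?_⟩
            simp only [inner_neg_left]
            rw [height_eq_inner] at h; linarith
          · refine ⟨(L e₃, ((s.1 : ℝ) + 1) * TentCertificate.hB + ⟪L e₃, sf⟫_ℝ), by simp [laySlabH], ?_⟩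
            simp only
            rw [height_eq_inner] at h; linarith
        obtain ⟨p₀, hp₀, hyp₀⟩ := hdat
        have hp₀𝓗 : p₀ ∈ I.𝓗 := I.laySlabH_subset_𝓗 f s.2 hp₀
        have hp₀q : p₀ = q := by
          have h' : p₀ = q ∨ p₀ = antip q := by by_contra h; exact hgen p₀ hp₀𝓗 h hyp₀
          rcases h' with h' | h'
          · exact h'
          · exfalso
            obtain ⟨z, hz⟩ := hne
            have h1 : ⟪p₀.1, z⟫_ℝ < p₀.2 := by
              have := hS hz; rw [laySlab_eq_polytope] at this
              simp only [polytope, mem_iInter, mem_setOf_eq] at this; exact this p₀ hp₀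
            have h2 := hside hz
            simp only [mem_setOf_eq] at h2
            rw [h'] at h1; simp only [antip, inner_neg_left] at h1
            linarith
        have hqL : q.1 = L e₃ ∨ q.1 = -(L e₃) := by
          rw [← hp₀q]; simp only [laySlabH, Finset.mem_insert, Finset.mem_singleton] at hp₀
          rcases hp₀ with rfl | rfl
          · exact Or.inl rfl
          · exact Or.inr rfl
        -- `y` is on a layer plane of piece `jc`
        have hylp : y ∈ layerPlane L sf ((I.ct f).slabOf jc) ∪ layerPlane L sf ((I.ct f).slabOf jc + 1) := by
          rw [hslab_jc]
          rcases hh with h | h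
          · exact Or.inl ((mem_layerPlane_iff_height L sf _ y).2 h)
          · refine Or.inr ((mem_layerPlane_iff_height L sf _ y).2 ?_)
            rw [h]; push_cast; ring
        -- off the LayerPlaneCover null set: covered by another piece
        have hcov : y ∈ ⋃ j' : {j' : Fin (I.ct f).J // j' ≠ jc}, closure (polytope ((I.ct f).H j')) := by
          by_contra h
          exact hyN (Or.inl (by simp only [hNLP, if_pos hqL]; exact ⟨⟨⟨hyH, hylp⟩, h⟩, hycl⟩))
        obtain ⟨⟨j', hj'⟩, hyj'⟩ := mem_iUnion.1 hcov
        -- that piece does not carry `q` (same-side null set) …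
        have hslab_side : polytope ((I.ct f).H jc) ⊆ {z : E3 | ⟪q.1, z⟫_ℝ < q.2} := by
          intro z hz
          have := (I.ct f).hslab jc hz
          rw [hslab_jc, laySlab_eq_polytope] at this
          simp only [polytope, mem_iInter, mem_setOf_eq] at this
          have h1 := this p₀ hp₀
          rw [hp₀q] at h1; exact h1
        have hqj' : q ∉ (I.ct f).H j' := by
          intro hqj'
          exact hyN (Or.inr (mem_iUnion₂.2 ⟨j', Finset.mem_filter.2 ⟨Finset.mem_univ _, hj', hqj', hslab_side⟩, ⟨⟨⟨hyH, hyj'⟩, hyq⟩, hycl⟩⟩))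
        -- … hence carries `antip q` (else `y` would be inside it, and the cell would meet two disjoint pieces)
        have haq : antip q ∈ (I.ct f).H j' := by
          by_contra haq
          have hyin' : y ∈ polytope ((I.ct f).H j') := by
            simp only [polytope, mem_iInter, mem_setOf_eq]
            intro p hp
            have hne1 : ¬ (p = q ∨ p = antip q) := by
              rintro (rfl | rfl); exacts [hqj' hp, haq hp]
            exact lt_of_le_of_ne (inner_le_of_mem_closure_polytope _ hyj' p hp) (hgen p (I.certH_subset_𝓗 f j' hp) hne1)
          obtain ⟨ε, hε, hb⟩ := Metric.isOpen_iff.1 (isOpen_polytopeH ((I.ct f).H j')) y hyin'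
          obtain ⟨z, hzb, hzc⟩ := Metric.mem_closure_iff.1 hycl ε hε
          have hzj' : z ∈ polytope ((I.ct f).H j') := hb (by rw [Metric.mem_ball, dist_comm]; exact hzc)
          exact Set.disjoint_left.1 ((I.ct f).hdisj jc j' (Ne.symm hj')) (hH hzb) hzj'
        have hstrict : ∀ p ∈ (I.ct f).H j', p ≠ antip q → ⟪p.1, y⟫_ℝ < p.2 := by
          intro p hp hpa
          have hne1 : ¬ (p = q ∨ p = antip q) := by
            rintro (rfl | rfl); exacts [hqj' hp, hpa rfl]
          exact lt_of_le_of_ne (inner_le_of_mem_closure_polytope _ hyj' p hp) (hgen p (I.certH_subset_𝓗 f j' hp) hne1)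
        obtain ⟨ε₂, hε₂, hfar₂⟩ := exists_ball_far_subset_polytope hstrict
        refine ⟨min ε₁ ε₂, lt_min hε₁ hε₂, fun z hz hzq hzN => ?_⟩
        have hzD : z ∈ polytope (μ.HD f jd') := hball₁ (Metric.ball_subset_ball (min_le_left _ _) hz)
        have hzH : z ∈ polytope ((I.ct f).H j') := hfar₂ ⟨Metric.ball_subset_ball (min_le_right _ _) hz, hzq⟩
        exact I.mem_pieceSet_of_certH_of_HD f j' jd' hzH hzD hzN
  · -- on the frontier of the territory
    have hyfr : y ∈ frontier (⋃ j, polytope (μ.HD f j)) := by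
      rw [(isOpen_iUnion fun j => isOpen_polytopeH (μ.HD f j)).frontier_eq]
      exact ⟨hyDcl, hyin⟩
    rcases μ.hbdry f y hyfr with ⟨hE, -⟩ | ⟨j, p, hp, hyp⟩ | ⟨r, hr, hsol, hball⟩
    · exfalso
      have hyG : y ∈ closure (I.ct f).G := by
        refine closure_mono (fun z hz => ?_) hyH
        rw [(I.ct f).hG]; exact mem_iUnion.2 ⟨jc, hz⟩
      exact CellCover.not_mem_closure_of_emptyAt _ f hE (I.ct f).hnear hyG
    · exact absurd (Or.inr (I.mem_desOf_of_desD hgen hp hyp)) hyA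
    · refine ⟨r, hr, fun z hz _ hzN => ?_⟩
      rcases hball hz with hzD | ((((hB | hC) | hD') | hE) | hF)
      · exact I.mem_pieceSet_of_territory f hzD (fun hzU => hsol z hz hzU) hzN
      · obtain ⟨k, -, hzk⟩ := mem_iUnion₂.1 hB
        exact I.mem_pieceSet_of_prism k hzk.1 hzN
      · obtain ⟨k, -, hzk⟩ := mem_iUnion₂.1 hC
        exact I.mem_pieceSet_of_prism k hzk.1 hzN
      · obtain ⟨l, -, hzl⟩ := mem_iUnion₂.1 hD'
        exact I.mem_pieceSet_of_gap l hzl hzN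
      · obtain ⟨r', -, hzr⟩ := mem_iUnion₂.1 hE
        exact I.mem_pieceSet_of_box r' hzr hzN
      · obtain ⟨g, -, hzg⟩ := mem_iUnion₂.1 hF
        exact I.mem_pieceSet_of_territory g hzg.1 hzg.2.1 hzN

end TexInput

end Summit.Ventures.Crystal3D.Cruxes.TextureLiminf.TexShadow

end
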